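import Summits.BirchSwinnertonDyer.BirchSwinnertonDyer.Theorems.CyclotomicUntwistRohrlichAtkinLehnerSeries
import HarnessLib

/-!
# Rohrlich's first moment at a prime DIVIDING the level, II: no admissible family of large
# `p`-power conductor is killed by the symbol sums (`w_Q`-version of the tree's asymptotics)

Cell `pub/bsd-wall` (D-0145 line `route-BirchSwinnertonDyer-CyclotomicUntwist`), seat `bsd-line-cycu-p1`
(prover seat 1/3), helper toward crux K1 `PSRankOneLowerHalfAtThree` (stmt-BirchSwinnertonDyer-21580),
continuation of `CyclotomicUntwistRohrlichAtkinLehnerSeries`. THEOREMS ONLY (no definition, no named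
fact, no `sorry`); BSD is not proved by this file and no crux is.

* `exists_forall_family_exists_twistedSymbolSum_ne_zero_atkinLehner` — let `f ∈ S₂(Γ₀(N))` with
  `a₁ = 1`, `|aₙ| ≤ C n^θ` for some `θ < 2/3`, and `w_Q f = ε f` for an exact divisor `Q ∥ N` with
  `p ∤ Q` and `N ∣ Q p^{a₀}` (so `N/Q` is a power of `p`; `ε² = 1`). Then there is `m₀` such that for
  every `m ≥ m₀` and every non-empty family `X` of primitive characters mod `p^m` of constant parity
  whose character sum is supported in `{z : z^{2(p-1)} ≡ 1 (mod p^{m-1})}`, some `χ ∈ X` has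
  `∑_a χ̄(a){∞, a/p^m}_f ≠ 0`. This is the tree's `exists_forall_family_exists_twistedSymbolSum_ne_zero`
  (`RohrlichNonvanishingProofs`, hypothesis `p ∤ N`, Fricke pair `(f, w_N f)`) with the level `N`
  replaced by its prime-to-`p` part `Q` throughout: first moment
  `ε_X #X (e^{-2πY} + O(δ_m))`, `Y = p^{-am}`, `3/2 < a < 1/θ`, main error by the sparse support
  (`norm_dampedTwist_sum_sub_le_of_support`, unchanged), dual error by the Kloosterman bound with the
  weight `χ(Q)` (`norm_dampedTwist_dual_le_of_support_unit`) at `Y' = 1/(Q p^{2m} Y)`.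

References: [cite: RohrlichInventiones1984, §§2–4]; [cite: Knapp1993, Lemma 9.24]; Kato, Astérisque 295
(2004), Thm. 13.5 (2) (p. 227), quoting Rohrlich, Math. Ann. 281 (1988).
-/

noncomputable section

open scoped MatrixGroups Real

open CongruenceSubgroup Literature.NumberTheory.EllipticCurves
  Literature.NumberTheory.EllipticCurves.ModularForms UpperHalfPlane Finset Filter Topology
  Summit.BirchSwinnertonDyer.BirchSwinnertonDyer.Theorems.PSRohrlichAL

-- single-conjunct summit: `Summit.BirchSwinnertonDyer.BirchSwinnertonDyer.…` repeats the name by design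
set_option linter.dupNamespace false
set_option autoImplicit false

namespace Summit.BirchSwinnertonDyer.BirchSwinnertonDyer.Theorems.PSRohrlichALMoment

variable {p : ℕ} [hp : Fact p.Prime]
variable {N : ℕ} [NeZero N] (f : CuspForm (Gamma0 N) 2) {Q : ℕ} [NeZero Q]

/-- **No admissible family of large `p`-power conductor is killed by the symbol sums — at a prime
`p` dividing the level.** Let `f ∈ S₂(Γ₀(N))` with `a₁(f) = 1`, `|aₙ(f)| ≤ C n^θ` for some `θ < 2/3`,
and `w_Q f = ε f` (`ε² = 1`) for an exact divisor `Q ∥ N` with `p ∤ Q`, `N ∣ Q p^{a₀}`. Then there is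
`m₀` such that for every `m ≥ m₀` and every non-empty family `X` of primitive characters mod `p^m` of
constant parity whose character sum is supported in `{z : z^{2(p-1)} ≡ 1 (mod p^{m-1})}`, some `χ ∈ X`
has `∑_a χ̄(a){∞, a/p^m}_f ≠ 0` (Rohrlich 1984, §§2–4, with the Atkin–Lehner flip at `Q` in place of
the Fricke flip at `N`: `sum_family_twistedSymbolSum_eq_atkinLehner`,
`norm_dampedTwist_sum_sub_le_of_support`, `norm_dampedTwist_dual_le_of_support_unit`; the threshold also
absorbs `m ≥ a₀`). [cite: RohrlichInventiones1984, §§2–4] -/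
theorem exists_forall_family_exists_twistedSymbolSum_ne_zero_atkinLehner (hQN : Q ∣ N)
    (hc : Nat.Coprime Q (N / Q)) {ε : ℂ} (hε : atkinLehnerInvolution N 2 Q f = ε • f)
    (hε1 : ε ^ 2 = 1) (hpQ : ¬ p ∣ Q) {a₀ : ℕ} (hNa : N ∣ Q * p ^ a₀)
    {C θ : ℝ} (hC : 0 ≤ C) (hθ : 0 < θ) (hθ1 : θ < 2 / 3)
    (ha : ∀ n : ℕ, ‖cuspCoeff f n‖ ≤ C * (n : ℝ) ^ θ) (h1 : cuspCoeff f 1 = 1) :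
    ∃ m₀ : ℕ, ∀ m : ℕ, m₀ ≤ m → ∀ (X : Finset (DirichletCharacter ℂ (p ^ m))) (εX : ℂ),
      X.Nonempty → (∀ χ ∈ X, χ.IsPrimitive ∧ χ (-1) = εX) →
      (∀ z : ZMod (p ^ m), ∑ χ ∈ X, χ z ≠ 0 →
        (ZMod.castHom (pow_dvd_pow p (Nat.sub_le m 1)) (ZMod (p ^ (m - 1))) z) ^ (2 * (p - 1)) = 1) →
      ∃ χ ∈ X, twistedSymbolSum f χ⁻¹ ≠ 0 := by
  have hpr : (1 : ℝ) < p := by exact_mod_cast hp.out.one_lt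
  have hp0 : (0 : ℝ) < p := by linarith
  have hQr : (0 : ℝ) < Q := Nat.cast_pos.mpr (NeZero.pos Q)
  have h2π : (0 : ℝ) < 2 * Real.pi := Real.two_pi_pos
  have hθle : θ ≤ 1 := by linarith
  have hεn : ‖ε‖ = 1 := by
    have h : ‖ε‖ ^ 2 = 1 := by rw [← norm_pow, hε1, norm_one]
    exact (pow_eq_one_iff_of_nonneg (norm_nonneg ε) two_ne_zero).mp h
  -- the exponent `a`, `3/2 < a < 1/θ`
  set a : ℝ := 3 / 4 + 1 / (2 * θ) with hadef
  have haθ' : a * θ = 3 / 4 * θ + 1 / 2 := by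
    rw [hadef]; field_simp
  have haθ : a * θ - 1 < 0 := by rw [haθ']; linarith
  have ha32 : 3 / 2 < a := by
    have : 3 / 4 < 1 / (2 * θ) := by
      rw [lt_div_iff₀ (by positivity)]; linarith
    rw [hadef]; linarith
  have ha0 : 0 < a := by linarith
  have hdual : (2 - a) * θ - 1 / 2 < 0 := by nlinarith [mul_pos (sub_pos.mpr ha32) hθ, hθle]
  -- the parameters as functions of `m`
  set X : ℕ → ℝ := fun m ↦ (p : ℝ) ^ m with hXdef
  set q : ℕ → ℝ := fun m ↦ (p : ℝ) ^ (m - 1) with hqdef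
  set Y : ℕ → ℝ := fun m ↦ X m ^ (-a) with hYdef
  have hXpos : ∀ m, 0 < X m := fun m ↦ pow_pos hp0 m
  have hqpos : ∀ m, 0 < q m := fun m ↦ pow_pos hp0 _
  have hYpos : ∀ m, 0 < Y m := fun m ↦ Real.rpow_pos_of_pos (hXpos m) _
  have hXq : ∀ m, m ≠ 0 → X m = p * q m := fun m hm ↦ by
    simp only [hXdef, hqdef]
    rw [← pow_succ', Nat.sub_add_cancel (Nat.pos_of_ne_zero hm)]
  -- the error sequences
  set e₁ : ℝ := (θ - 1) / (2 * (p - 1) : ℝ) with he₁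
  set K₃ : ℝ := Real.Gamma θ * ((2 * Real.pi) ^ (-θ) * (p : ℝ) ^ (a * θ)) with hK₃
  set err₁ : ℕ → ℝ := fun m ↦ C * ((4 * p : ℕ) *
    (q m ^ e₁ + (q m ^ (θ - 1) + K₃ * q m ^ (a * θ - 1)))) with herr₁
  set K₄ : ℝ := C * ((4 * p * p : ℕ) * (4 * (p : ℝ))) with hK₄
  set K₅ : ℝ := Real.Gamma θ * (2 * Real.pi / Q) ^ (-θ) with hK₅
  set err₂ : ℕ → ℝ := fun m ↦ K₄ * (X m ^ (-(1 / 2 : ℝ)) + K₅ * X m ^ ((2 - a) * θ - 1 / 2))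
    with herr₂
  -- limits
  have hXlim : Tendsto X atTop atTop := tendsto_pow_atTop_atTop_of_one_lt hpr
  have hqlim : Tendsto q atTop atTop :=
    (tendsto_pow_atTop_atTop_of_one_lt hpr).comp (tendsto_sub_atTop_nat 1)
  have hrpow : ∀ {Z : ℕ → ℝ} (_ : Tendsto Z atTop atTop) {e : ℝ} (_ : e < 0),
      Tendsto (fun m ↦ Z m ^ e) atTop (𝓝 0) := by
    intro Z hZ e he
    have h := (tendsto_rpow_neg_atTop (neg_pos.mpr he)).comp hZ
    simp only [neg_neg] at h
    exact h
  have he₁neg : e₁ < 0 := div_neg_of_neg_of_pos (by linarith) (by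
    have : (2 : ℝ) ≤ p := by exact_mod_cast hp.out.two_le
    linarith)
  have herr₁lim : Tendsto err₁ atTop (𝓝 0) := by
    have h := ((hrpow hqlim he₁neg).add ((hrpow hqlim (by linarith : θ - 1 < 0)).add
      ((hrpow hqlim haθ).const_mul K₃))).const_mul ((4 * p : ℕ) : ℝ)
      |>.const_mul C
    simpa [herr₁] using h
  have herr₂lim : Tendsto err₂ atTop (𝓝 0) := by
    have h := ((hrpow hXlim (by norm_num : -(1 / 2 : ℝ) < 0)).add
      ((hrpow hXlim hdual).const_mul K₅)).const_mul K₄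
    simpa [herr₂] using h
  have hexplim : Tendsto (fun m ↦ Real.exp (-(2 * Real.pi) * Y m)) atTop (𝓝 1) := by
    have hY0 : Tendsto Y atTop (𝓝 0) := hrpow hXlim (by linarith : -a < 0)
    have h0 : Tendsto (fun m ↦ -(2 * Real.pi) * Y m) atTop (𝓝 0) := by
      simpa using hY0.const_mul (-(2 * Real.pi))
    have := (Real.continuous_exp.tendsto 0).comp h0
    rw [Real.exp_zero] at this
    refine this.congr fun m ↦ ?_
    simp only [Function.comp_apply]
  -- choose `m₀`
  have hev : ∀ᶠ m in atTop, err₁ m + err₂ m < 1 / 2 ∧ 1 / 2 < Real.exp (-(2 * Real.pi) * Y m) ∧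
      1 ≤ m ∧ a₀ ≤ m := by
    refine ((herr₁lim.add herr₂lim).eventually (gt_mem_nhds ?_)).and
      ((hexplim.eventually (lt_mem_nhds ?_)).and ((eventually_ge_atTop 1).and
        (eventually_ge_atTop a₀)))
    · norm_num
    · norm_num
  obtain ⟨m₀, hm₀⟩ := eventually_atTop.mp hev
  refine ⟨m₀, fun m hm Xf εX hne hXf hsupp ↦ ?_⟩
  obtain ⟨hlt, hexp, hm1, hma⟩ := hm₀ m hm
  haveI : NeZero (p ^ m) := ⟨pow_ne_zero _ hp.out.ne_zero⟩
  have hNm : N ∣ Q * p ^ m := hNa.trans (mul_dvd_mul_left Q (pow_dvd_pow p hma))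
  -- suppose all the twisted symbol sums vanish
  by_contra hall
  push Not at hall
  have hm0 : m ≠ 0 := by omega
  have hcard : 0 < (Xf.card : ℝ) := by exact_mod_cast Finset.card_pos.mpr hne
  -- `εX ≠ 0`
  have hεX : εX ≠ 0 := by
    obtain ⟨χ, hχ⟩ := hne
    rw [← (hXf χ hχ).2]
    rcases apply_neg_one_eq_one_or χ with h | h
    · rw [h]; exact one_ne_zero
    · rw [h]; exact neg_ne_zero.mpr one_ne_zero
  -- the moment vanishes
  have hmom : ∑ χ ∈ Xf, gaussSum χ (ZMod.stdAddChar (N := p ^ m)) / (p ^ m : ℂ) *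
      twistedSymbolSum f χ⁻¹ = 0 :=
    Finset.sum_eq_zero fun χ hχ ↦ by rw [hall χ hχ, mul_zero]
  rw [sum_family_twistedSymbolSum_eq_atkinLehner f hQN hc hε hε1 hpQ hNm Xf hXf (hYpos m)] at hmom
  replace hmom := (mul_eq_zero.mp hmom).resolve_left hεX
  -- the two error bounds at `Y = Y m`
  have hE₁ := norm_dampedTwist_sum_sub_le_of_support f (p := p) Xf hsupp hC hθ hθle
    ha h1 (hYpos m)
  have hY'pos : 0 < 1 / ((Q : ℝ) * (p ^ m : ℕ) ^ 2 * Y m) := by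
    have : (0 : ℝ) < (p ^ m : ℕ) := Nat.cast_pos.mpr (pow_pos hp.out.pos _)
    have := hYpos m
    positivity
  have hE₂ := norm_dampedTwist_dual_le_of_support_unit f (p := p) hm0 hpQ Xf hsupp hC hθ hθle ha
    hY'pos
  -- simplify the error bounds to `#X · err₁ m` and `#X · err₂ m`
  have hqM : ((p ^ (m - 1) : ℕ) : ℝ) = q m := by simp [hqdef]
  have hXM : ((p ^ m : ℕ) : ℝ) = X m := by simp [hXdef]
  have hA : (q m ^ (1 / (2 * (p - 1) : ℝ))) ^ (θ - 1) = q m ^ e₁ := by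
    rw [← Real.rpow_mul (hqpos m).le, he₁]
    congr 1
    have : (2 * (p - 1) : ℝ) ≠ 0 := by
      have : (2 : ℝ) ≤ p := by exact_mod_cast hp.out.two_le
      intro h; linarith
    field_simp
  have hB : q m ^ (θ - 1) * (1 + Real.Gamma θ * (2 * Real.pi * Y m * q m) ^ (-θ)) =
      q m ^ (θ - 1) + K₃ * q m ^ (a * θ - 1) := by
    rw [hYdef]
    dsimp only
    rw [hXq m hm0, hK₃]
    have h := main_exponent_eq_offset (θ := θ) (a := a) hp0 (hqpos m)
    linear_combination Real.Gamma θ * h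
  have hE₁' : ‖dampedTwist f (fun n ↦ ∑ χ ∈ Xf, χ n) (Y m) -
      Xf.card * (Real.exp (-(2 * Real.pi) * Y m) : ℝ)‖ ≤ Xf.card * err₁ m := by
    have h := hE₁
    rw [hqM, hA, hB] at h
    simpa only [herr₁] using h
  have hE₂' : ‖ε * (1 / (p ^ m : ℂ)) * dampedTwist f (fun n ↦ ∑ χ ∈ Xf,
      χ Q * gaussSum χ (ZMod.stdAddChar (N := p ^ m)) ^ 2 * χ⁻¹ n)
        (1 / ((Q : ℝ) * (p ^ m : ℕ) ^ 2 * Y m))‖ ≤ Xf.card * err₂ m := by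
    rw [norm_mul, norm_mul, hεn, one_mul, norm_div, norm_one, show ‖(p ^ m : ℂ)‖ = X m by
      rw [show (p ^ m : ℂ) = ((p ^ m : ℕ) : ℂ) by push_cast; rfl, Complex.norm_natCast, hXM]]
    refine (mul_le_mul_of_nonneg_left hE₂ (by positivity)).trans ?_
    rw [hXM]
    have hZ : (2 * Real.pi * (1 / ((Q : ℝ) * X m ^ 2 * Y m))) ^ (-θ) =
        (2 * Real.pi / Q) ^ (-θ) * X m ^ ((2 - a) * θ) := by
      rw [hYdef]; exact dual_exponent_eq_offset hQr (hXpos m)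
    have hpk : (p : ℝ) ^ (m - m / 2) ≤ p * X m ^ (1 / 2 : ℝ) := pow_ceil_half_le_offset hpr.le m
    have hG : 0 ≤ Real.Gamma θ := (Real.Gamma_pos_of_pos hθ).le
    have hx1 : X m ^ (1 / 2 : ℝ) / X m = X m ^ (-(1 / 2 : ℝ)) := by
      rw [div_eq_iff (hXpos m).ne', ← Real.rpow_add_one (hXpos m).ne']
      norm_num
    have hx2 : X m ^ (1 / 2 : ℝ) * X m ^ ((2 - a) * θ) / X m = X m ^ ((2 - a) * θ - 1 / 2) := by
      rw [div_eq_iff (hXpos m).ne', ← Real.rpow_add (hXpos m), ← Real.rpow_add_one (hXpos m).ne']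
      congr 1; ring
    rw [hZ]
    calc 1 / X m * ((Xf.card) * (C * (((4 * p * p : ℕ) * (4 * (p : ℝ) ^ (m - m / 2))) *
          (1 + Real.Gamma θ * ((2 * Real.pi / Q) ^ (-θ) * X m ^ ((2 - a) * θ))))))
        ≤ 1 / X m * ((Xf.card) * (C * (((4 * p * p : ℕ) * (4 * ((p : ℝ) * X m ^ (1 / 2 : ℝ)))) *
          (1 + Real.Gamma θ * ((2 * Real.pi / Q) ^ (-θ) * X m ^ ((2 - a) * θ)))))) := by
          gcongr
      _ = (Xf.card) * (C * ((4 * p * p : ℕ) * (4 * (p : ℝ)))) *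
          (X m ^ (1 / 2 : ℝ) / X m + Real.Gamma θ * (2 * Real.pi / Q) ^ (-θ) *
            (X m ^ (1 / 2 : ℝ) * X m ^ ((2 - a) * θ) / X m)) := by
          ring
      _ = (Xf.card) * err₂ m := by
          rw [hx1, hx2]
          simp only [herr₂, hK₄, hK₅]
          ring
  -- the contradiction
  have hkey : (Xf.card : ℝ) * Real.exp (-(2 * Real.pi) * Y m) ≤
      Xf.card * err₁ m + Xf.card * err₂ m := by
    have hnorm : ‖((Xf.card) * (Real.exp (-(2 * Real.pi) * Y m) : ℝ) : ℂ)‖ =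
        (Xf.card : ℝ) * Real.exp (-(2 * Real.pi) * Y m) := by
      rw [show ((Xf.card) * (Real.exp (-(2 * Real.pi) * Y m) : ℝ) : ℂ) =
        (((Xf.card) * Real.exp (-(2 * Real.pi) * Y m) : ℝ) : ℂ) by push_cast; ring,
        Complex.norm_real, Real.norm_of_nonneg (by positivity)]
    rw [← hnorm]
    set D₁ := dampedTwist f (fun n ↦ ∑ χ ∈ Xf, χ n) (Y m)
    set D₂ := ε * (1 / (p ^ m : ℂ)) * dampedTwist f (fun n ↦ ∑ χ ∈ Xf,
      χ Q * gaussSum χ (ZMod.stdAddChar (N := p ^ m)) ^ 2 * χ⁻¹ n)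
        (1 / ((Q : ℝ) * (p ^ m : ℕ) ^ 2 * Y m))
    have hD : D₁ = D₂ := sub_eq_zero.mp hmom
    calc ‖((Xf.card) * (Real.exp (-(2 * Real.pi) * Y m) : ℝ) : ℂ)‖
        = ‖((((Xf.card) * (Real.exp (-(2 * Real.pi) * Y m) : ℝ) : ℂ) - D₁) + D₂)‖ := by
          rw [hD, sub_add_cancel]
      _ ≤ ‖((Xf.card) * (Real.exp (-(2 * Real.pi) * Y m) : ℝ) : ℂ) - D₁‖ + ‖D₂‖ :=
          norm_add_le _ _
      _ ≤ _ := by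
          refine add_le_add ?_ hE₂'
          rw [norm_sub_rev]; exact hE₁'
  have : Real.exp (-(2 * Real.pi) * Y m) ≤ err₁ m + err₂ m := by
    have h := hkey
    rw [← mul_add] at h
    exact le_of_mul_le_mul_left h hcard
  linarith

end Summit.BirchSwinnertonDyer.BirchSwinnertonDyer.Theorems.PSRohrlichALMoment

end
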